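import Literature.MathematicalPhysics.QuantumFieldTheory.Balaban1983to89.BlockAveragingEMLLinearised
import Literature.MathematicalPhysics.QuantumFieldTheory.Balaban1983to89.MatrixLog
import Literature.Analysis.Calculus.BCHProductLowOrder
import HarnessLib

/-!
# `AlphaInputsT3ACv3ExpWalkSecondOrder` — STRATEGY B for 2′, NON-ABELIAN (FL) input (B2), core: THE LOGARITHM OF THE PARALLEL TRANSPORT OF AN
# EXPONENTIAL FIELD ALONG ANY WALK TO **SECOND ORDER** — `log U(Γ) = Σ_{b⊂Γ} ±Y_b + ½Σ_{b₁≺b₂}[±Y_{b₁}, ±Y_{b₂}] + O((|Γ|·sup‖Y‖)³)`, with an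
# absolute constant — lane `pub-balaban3d` ∕ cell `ym3-torus`, seat `ym-ust-19936-w1` (g0)

WHY (HOME `ym-ust-19936-w1/NONABELIAN-FL-ARCH-w1-g0.md` §8, evidence #52 on stmt-QuantumFields-19936).  The k-uniform non-abelian (FL) construction
(level-by-level exact lift) needs SECOND-ORDER candidates: the one genuinely new analytic input beyond the tree and the abelian (LL) is (B2) = the
second-order term of [Balaban1985Averaging] Prop. 3 for the (0.4)∕`exp[mean log]` average of a field `U_b = e^{Y_b}` at the flat background, with a
CUBIC remainder.  Since `exp[mean log]` of exponentials is EXACTLY the exponential of the mean of the logs (`BlockAveragingEMLAnalyticMean.eml_exp`), the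
whole second order of `log Ū(c)` lives in the logarithms of the LOOP AND LINE HOLONOMIES of (0.4), i.e. in the Baker–Campbell–Hausdorff series of an
ordered product of bond exponentials — whose cubic truncation with an `n`-independent quartic tail is in the tree (`Literature.Analysis.Calculus.BCH`:
`norm_log_prodExp_sub_bch3List_le`, [Balaban1985Variational] (34) p.283 for the four bonds of a plaquette).  THIS FILE is the walk-level core:
* §1 `coe_holAt_eq_prodExp`: for `U_b = e^{Y_b}` with `Y_b* = −Y_b`, the matrix of the transport `U(Γ)` along ANY sequence of oriented steps is the
  ordered product of the exponentials `e^{±Y_b}` (backward steps: `U_b* = e^{Y_b*} = e^{−Y_b}`, `NormedSpace.star_exp`).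
* §2 `ns_signed_le` (`Σ‖±Y_b‖ ≤ |Γ|·δ`), and ★★ `norm_mlog_holAt_sub_second_order_le`: for `‖Y_b‖ ≤ δ` and `|Γ|·δ ≤ 1/10`,
  `‖log U(Γ) − (Y(Γ) + ½·pairBr(±Y along Γ))‖ ≤ 3400·(|Γ|·δ)³`, where `Y(Γ) = walkSum Y Γ` is the tree's signed sum
  (`BlockAveragingEMLLinearised.walkSum`) and `pairBr [y₁,…,y_m] = Σ_{i<j}[yᵢ,yⱼ]` the tree's commutator sum (`BCH.pairBr`) — the SECOND-ORDER
  TERM IS A SUM OF COMMUTATORS, so it vanishes for abelian data (consistency with the abelian (LL) row: `AbelianEML.iter_blockAvg_gexpAt` is exact);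
  `norm_mlog_holAt_sub_walkSum_le` (first order with quadratic remainder `≤ (|Γ|δ)²`, for comparison with `…EMLLinearised.norm_holAt_sub_one_sub_walkSum_le`).
HONEST FRAMING.  Kernel assembly of the tree's BCH file along the tree's walks; the (0.4) assembly (mean over the loop words + the axial line + the outer
`exp(mean log)·U(c)` product = `B₂(Y)(c)` of the memo) is the NEXT file.  Nothing of [Balaban1985Averaging]∕[Balaban1985Variational] asserted beyond what is
proved; count-neutral helper toward R3 2′ (items 19936∕19935∕20520); registry untouched; (FL) NOT proved here; nothing about d = 4, the continuum, or a
mass gap; YM₃ on T³ is rung R3, not Clay.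

References: T. Bałaban, Commun. Math. Phys. 102 (1985) 277–309 [Balaban1985Variational] ((34) p.283); CMP 98 (1985) 17–51 [Balaban1985Averaging]
((9) p.18, (21) p.21, Prop. 3 (121)–(125) p.36); W. Rossmann, *Lie Groups*, OUP 2002 [Rossmann2002] (§1.3 Thm 1, Problem 2).
-/

set_option autoImplicit false

noncomputable section

open scoped Matrix.Norms.L2Operator
open NormedSpace

namespace Summit.QuantumFields.YangMills.Theorems.ExpWalkSecondOrder

open Literature.MathematicalPhysics.QuantumFieldTheory.Balaban1983to89
open T4Continuum BlockAveraging MatrixLog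
open BlockAveragingEMLLinearised (walkSum stepFactor coe_holAt_eq_prod_stepFactor)
open Literature.Analysis.Calculus.BCH (pairBr bch3List ns ns_nonneg ns_cons ns_nil norm_log_prodExp_sub_bch3List_le norm_bch3List_sub_sum_sub_pair_le
  norm_bch3List_sub_sum_le)
open Literature.Analysis.Complex (logOnePlus)

variable {P : Params} {j : ℕ} {n : Type*} [Fintype n] [DecidableEq n] [Nonempty n]

/-! ## §1 The transport of an exponential field is the ordered product of the exponentials `e^{±Y_b}` -/

/-- **THE TRANSPORT OF `U_b = e^{Y_b}` (`Y_b* = −Y_b`) ALONG A SEQUENCE OF ORIENTED STEPS IS `Π e^{±Y_b}`** (backward steps contribute `U_b* = e^{−Y_b}`).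
[cite: Balaban1985Averaging, (9) p.18] -/
theorem coe_holAt_eq_prodExp (U : GaugeField P j (Matrix.specialUnitaryGroup n ℂ)) (Y : PBond P j → Matrix n n ℂ)
    (hUY : ∀ b, ((U b : Matrix.specialUnitaryGroup n ℂ) : Matrix n n ℂ) = exp (Y b)) (hY : ∀ b, star (Y b) = -Y b) (γ : List (LStep P j)) :
    ((holAt U γ : Matrix.specialUnitaryGroup n ℂ) : Matrix n n ℂ) = ((γ.map fun s => if s.fwd then Y s.bond else -Y s.bond).map exp).prod := by
  rw [coe_holAt_eq_prod_stepFactor, List.map_map]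
  congr 1
  refine List.map_congr_left fun s _ => ?_
  simp only [Function.comp_apply, stepFactor]
  by_cases hs : s.fwd = true
  · rw [if_pos hs, if_pos hs, hUY]
  · rw [if_neg hs, if_neg hs, hUY, star_exp, hY]

/-! ## §2 The logarithm to second order -/

omit [Nonempty n] in
/-- The size of the signed list of a walk: `Σ_{s∈Γ} ‖±Y_{b(s)}‖ ≤ |Γ|·δ` when `‖Y_b‖ ≤ δ`. [cite: Balaban1985Averaging, (9) p.18] -/
theorem ns_signed_le (Y : PBond P j → Matrix n n ℂ) {δ : ℝ} (hYδ : ∀ b, ‖Y b‖ ≤ δ) :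
    ∀ γ : List (LStep P j), ns (γ.map fun s => if s.fwd then Y s.bond else -Y s.bond) ≤ (γ.length : ℝ) * δ
  | [] => by simp
  | s :: γ => by
    rw [List.map_cons, ns_cons, List.length_cons, Nat.cast_succ, add_mul, one_mul, add_comm ((γ.length : ℝ) * δ)]
    refine add_le_add ?_ (ns_signed_le Y hYδ γ)
    cases s.fwd
    · simp only [Bool.false_eq_true, ↓reduceIte, norm_neg]; exact hYδ _
    · simp only [↓reduceIte]; exact hYδ _

omit [Fintype n] [DecidableEq n] [Nonempty n] in
/-- The signed list sums to the tree's signed walk sum `Y(Γ)`. [cite: Balaban1984PropagatorsI, (1.8) p.19] -/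
theorem sum_signed_eq_walkSum (Y : PBond P j → Matrix n n ℂ) (γ : List (LStep P j)) :
    (γ.map fun s => if s.fwd then Y s.bond else -Y s.bond).sum = walkSum Y γ := rfl

/-- **★★ THE LOGARITHM OF THE TRANSPORT OF AN EXPONENTIAL FIELD TO SECOND ORDER, CUBIC REMAINDER**: for `U_b = e^{Y_b}`, `Y_b* = −Y_b`, `‖Y_b‖ ≤ δ` and
a walk `Γ` with `|Γ|·δ ≤ 1/10`:  `‖log U(Γ) − (Y(Γ) + ½·Σ_{s<s′}[±Y_{b(s)}, ±Y_{b(s′)}])‖ ≤ 3400·(|Γ|·δ)³`  (`log` = the series `MatrixLog.mlog`; the second-order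
term is the commutator sum `BCH.pairBr` of the signed list, ZERO for commuting data).  Assembly of the tree's third-order BCH for ordered products
(`BCH.norm_log_prodExp_sub_bch3List_le`, tail `30000σ⁴`, and `norm_bch3List_sub_sum_sub_pair_le`, cubic part `σ³/3`).
[cite: Balaban1985Variational, (34) p.283; Balaban1985Averaging, (21) p.21] -/
theorem norm_mlog_holAt_sub_second_order_le (U : GaugeField P j (Matrix.specialUnitaryGroup n ℂ)) (Y : PBond P j → Matrix n n ℂ)
    (hUY : ∀ b, ((U b : Matrix.specialUnitaryGroup n ℂ) : Matrix n n ℂ) = exp (Y b)) (hY : ∀ b, star (Y b) = -Y b)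
    {δ : ℝ} (hYδ : ∀ b, ‖Y b‖ ≤ δ) (γ : List (LStep P j)) (hγ : (γ.length : ℝ) * δ ≤ 1 / 10) :
    ‖mlog ((holAt U γ : Matrix.specialUnitaryGroup n ℂ) : Matrix n n ℂ) -
        (walkSum Y γ + (2 : ℂ)⁻¹ • pairBr (γ.map fun s => if s.fwd then Y s.bond else -Y s.bond))‖ ≤ 3400 * ((γ.length : ℝ) * δ) ^ 3 := by
  set l : List (Matrix n n ℂ) := γ.map fun s => if s.fwd then Y s.bond else -Y s.bond with hl
  have hns0 : 0 ≤ ns l := ns_nonneg l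
  have hns : ns l ≤ (γ.length : ℝ) * δ := ns_signed_le Y hYδ γ
  have hns1 : ns l ≤ 1 / 10 := hns.trans hγ
  have hσ0 : 0 ≤ (γ.length : ℝ) * δ := hns0.trans hns
  -- the transport is the ordered product of exponentials; its series logarithm is `logOnePlus (Π − 1)`
  have hprod : ((holAt U γ : Matrix.specialUnitaryGroup n ℂ) : Matrix n n ℂ) = (l.map exp).prod := coe_holAt_eq_prodExp U Y hUY hY γ
  have hlog : mlog ((holAt U γ : Matrix.specialUnitaryGroup n ℂ) : Matrix n n ℂ) = logOnePlus ((l.map exp).prod - 1) := by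
    rw [mlog_def, hprod]
  -- third-order BCH with quartic tail, then drop the cubic words
  have h4 := norm_log_prodExp_sub_bch3List_le l hns1
  have h3 := norm_bch3List_sub_sum_sub_pair_le l
  have hsum : l.sum = walkSum Y γ := sum_signed_eq_walkSum Y γ
  have hsplit : mlog ((holAt U γ : Matrix.specialUnitaryGroup n ℂ) : Matrix n n ℂ) - (walkSum Y γ + (2 : ℂ)⁻¹ • pairBr l) =
      (logOnePlus ((l.map exp).prod - 1) - bch3List l) + (bch3List l - l.sum - (2 : ℂ)⁻¹ • pairBr l) := by
    rw [hlog, ← hsum]; abel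
  rw [hsplit]
  refine (norm_add_le _ _).trans ?_
  have hp3 : ns l ^ 3 ≤ ((γ.length : ℝ) * δ) ^ 3 := by gcongr
  have hp4 : ns l ^ 4 ≤ ((γ.length : ℝ) * δ) ^ 4 := by gcongr
  have h44 : ((γ.length : ℝ) * δ) ^ 4 ≤ (1 / 10) * ((γ.length : ℝ) * δ) ^ 3 := by
    have : ((γ.length : ℝ) * δ) ^ 4 = ((γ.length : ℝ) * δ) * ((γ.length : ℝ) * δ) ^ 3 := by ring
    rw [this]
    exact mul_le_mul_of_nonneg_right hγ (by positivity)
  calc ‖logOnePlus ((l.map exp).prod - 1) - bch3List l‖ + ‖bch3List l - l.sum - (2 : ℂ)⁻¹ • pairBr l‖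
      ≤ 30000 * ns l ^ 4 + 3⁻¹ * ns l ^ 3 := add_le_add h4 h3
    _ ≤ 30000 * ((1 / 10) * ((γ.length : ℝ) * δ) ^ 3) + 3⁻¹ * ((γ.length : ℝ) * δ) ^ 3 := by
        gcongr
        exact hp4.trans h44
    _ ≤ 3400 * ((γ.length : ℝ) * δ) ^ 3 := by nlinarith [pow_nonneg hσ0 3]

/-- **THE FIRST ORDER WITH QUADRATIC REMAINDER** (for comparison with `BlockAveragingEMLLinearised.norm_holAt_sub_one_sub_walkSum_le`, which expands `U(Γ) − 1`
rather than `log U(Γ)`): `‖log U(Γ) − Y(Γ)‖ ≤ 302·(|Γ|δ)²` for `|Γ|·δ ≤ 1/10` (the quartic tail `30000σ⁴ ≤ 300σ²` dominates the constant). [cite: Balaban1985Averaging, Prop. 3 (121)-(123) p.36] -/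
theorem norm_mlog_holAt_sub_walkSum_le (U : GaugeField P j (Matrix.specialUnitaryGroup n ℂ)) (Y : PBond P j → Matrix n n ℂ)
    (hUY : ∀ b, ((U b : Matrix.specialUnitaryGroup n ℂ) : Matrix n n ℂ) = exp (Y b)) (hY : ∀ b, star (Y b) = -Y b)
    {δ : ℝ} (hYδ : ∀ b, ‖Y b‖ ≤ δ) (γ : List (LStep P j)) (hγ : (γ.length : ℝ) * δ ≤ 1 / 10) :
    ‖mlog ((holAt U γ : Matrix.specialUnitaryGroup n ℂ) : Matrix n n ℂ) - walkSum Y γ‖ ≤ 302 * ((γ.length : ℝ) * δ) ^ 2 := by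
  set l : List (Matrix n n ℂ) := γ.map fun s => if s.fwd then Y s.bond else -Y s.bond with hl
  have hns0 : 0 ≤ ns l := ns_nonneg l
  have hns : ns l ≤ (γ.length : ℝ) * δ := ns_signed_le Y hYδ γ
  have hns1 : ns l ≤ 1 / 10 := hns.trans hγ
  have hσ0 : 0 ≤ (γ.length : ℝ) * δ := hns0.trans hns
  have hprod : ((holAt U γ : Matrix.specialUnitaryGroup n ℂ) : Matrix n n ℂ) = (l.map exp).prod := coe_holAt_eq_prodExp U Y hUY hY γ
  have hlog : mlog ((holAt U γ : Matrix.specialUnitaryGroup n ℂ) : Matrix n n ℂ) = logOnePlus ((l.map exp).prod - 1) := by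
    rw [mlog_def, hprod]
  have h4 := norm_log_prodExp_sub_bch3List_le l hns1
  have h2 := norm_bch3List_sub_sum_le l
  have hsum : l.sum = walkSum Y γ := sum_signed_eq_walkSum Y γ
  have hsplit : mlog ((holAt U γ : Matrix.specialUnitaryGroup n ℂ) : Matrix n n ℂ) - walkSum Y γ =
      (logOnePlus ((l.map exp).prod - 1) - bch3List l) + (bch3List l - l.sum) := by
    rw [hlog, ← hsum]; abel
  rw [hsplit]
  refine (norm_add_le _ _).trans ?_
  have hp2 : ns l ^ 2 ≤ ((γ.length : ℝ) * δ) ^ 2 := by gcongr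
  have hp3 : ns l ^ 3 ≤ ((γ.length : ℝ) * δ) ^ 3 := by gcongr
  have hp4 : ns l ^ 4 ≤ ((γ.length : ℝ) * δ) ^ 4 := by gcongr
  have h33 : ((γ.length : ℝ) * δ) ^ 3 ≤ (1 / 10) * ((γ.length : ℝ) * δ) ^ 2 := by
    have : ((γ.length : ℝ) * δ) ^ 3 = ((γ.length : ℝ) * δ) * ((γ.length : ℝ) * δ) ^ 2 := by ring
    rw [this]; exact mul_le_mul_of_nonneg_right hγ (by positivity)
  have h44 : ((γ.length : ℝ) * δ) ^ 4 ≤ (1 / 100) * ((γ.length : ℝ) * δ) ^ 2 := by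
    have : ((γ.length : ℝ) * δ) ^ 4 = (((γ.length : ℝ) * δ) * ((γ.length : ℝ) * δ)) * ((γ.length : ℝ) * δ) ^ 2 := by ring
    rw [this]
    refine mul_le_mul_of_nonneg_right ?_ (by positivity)
    nlinarith
  calc ‖logOnePlus ((l.map exp).prod - 1) - bch3List l‖ + ‖bch3List l - l.sum‖
      ≤ 30000 * ns l ^ 4 + (2⁻¹ * ns l ^ 2 + 3⁻¹ * ns l ^ 3) := add_le_add h4 h2
    _ ≤ 30000 * ((1 / 100) * ((γ.length : ℝ) * δ) ^ 2) + (2⁻¹ * ((γ.length : ℝ) * δ) ^ 2 + 3⁻¹ * ((1 / 10) * ((γ.length : ℝ) * δ) ^ 2)) := by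
        gcongr
        · exact hp4.trans h44
        · exact hp3.trans h33
    _ ≤ 302 * ((γ.length : ℝ) * δ) ^ 2 := by nlinarith [pow_nonneg hσ0 2]

end Summit.QuantumFields.YangMills.Theorems.ExpWalkSecondOrder

end
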